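import Mathlib
import Summits.NavierStokesRegularity.NavierStokesRegularity.Theorems.EulerZoomLiouvillePowerGaugeEulerLiouvilleMirrorMomentEndgame
import Summits.NavierStokesRegularity.NavierStokesRegularity.Theorems.EulerZoomLiouvillePowerGaugeEulerLiouvilleMirrorMomentBlobPersistence
import Summits.NavierStokesRegularity.NavierStokesRegularity.Theorems.EulerZoomLiouvillePowerGaugeEulerLiouvilleCasimirFloor
import Summits.NavierStokesRegularity.NavierStokesRegularity.Theorems.EulerZoomLiouvillePowerGaugeEulerLiouvilleMirrorMomentLedgerBound
import HarnessLib

/-!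
# Crux `EulerZoomLiouville.PowerGaugeEulerLiouville` (stmt-NavierStokesRegularity-19832), line `mirror-moment`:
# THE MIRROR-OUTGOING STRATUM MODULO THE LEVER M1 — member-level assembly M2 ∘ M3 ∘ M4 by name, M1 as the one hypothesis

Route №10 `EulerZoomLiouville` (NavierStokesRegularity), crux E.  Line `mirror-moment` (ideator ns-idea-11 g3;
`Cruxes/PowerGaugeEulerLiouville/Lines/mirror_moment.lean`).  Three of its four provable stubs are tree theorems —
M2 `MirrorMoment.blobsPersist_of_mirrorOutgoingWith` (`…MirrorMomentBlobPersistence`, ns-ezl-w3: ledger blobs persist backward),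
M3 `CasimirFloor.casimirFloor` (`…CasimirFloor`, ns-cas-k2: the Casimir enstrophy floor, statement shared verbatim with LINE A),
M4 `MirrorMoment.mirrorEndgame` (`…MirrorMomentEndgame`, this seat: floor + moment + blobs + `E`-gauge ⇒ irrotational past ⇒ trivial) —
and the lever M1 `stub_momentMonotone` (the axial ledger moment is non-decreasing; owner ns-sfl-p1 g3, slice-side sign lemma
`MirrorMoment.integral_axialFlux_nonneg` landed) is the one open brick.  This file composes the three landed stubs so that the STRATUM
STATEMENT of the line is available the hour M1 lands, with M1's registered signature (`Sig.stub_momentMonotone`, δ-unfolded) as its ONLY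
hypothesis:

* `mirrorOutgoing_ae_eq_zero_of_momentMonotone` — `Sig.stub_momentMonotone → (∀ ρ, 0 < ρ → ρ ≤ 1/2 → ∀ u p H c, InClass ρ u p H c →
  IsMirrorOutgoing ρ u p → u =ᵐ 0)` with every line `def` (`InClass`, `IsMirrorOutgoing`, `IsMirrorOutgoingWith`, `MomentMonotone`,
  `axialMoment`, `axisLedger`, `reflZ`, `VanishesAE`) unfolded verbatim: in the window, classical mirror-outgoing swirl-free members of the
  ρ-class with radial spreading exponent `β < 1/(2−ρ)` are trivial, GIVEN M1.  One-name target for the lead's `stub_mirrorOutgoing` once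
  M1 is a theorem `T`: `mirrorOutgoing_ae_eq_zero_of_momentMonotone T`.

WHAT THIS IS NOT: not NS, not the crux, and CONDITIONAL on M1 (a hypothesis, not a named fact) — bookkeeping `--supports` stmt-19832 for a
stratum of a hypothetical Euler zoom-limit class; no summit statement is proved here.
[cite: ChoiJeong2025, Lemma 3.3; CaffarelliKohnNirenberg1982, §2]
-/

noncomputable section

-- flat `Theorems/<Route><Decl>…` files of one crux share the namespace of the crux (tree convention)
set_option linter.dupNamespace false

open MeasureTheory Set Filter Topology Metric Function
open scoped NNReal ENNReal

namespace Summit.NavierStokesRegularity.NavierStokesRegularity.Theorems.PowerGaugeEulerLiouville.MirrorMoment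

open Literature.Analysis Literature.Analysis.FluidPDE
open Summit.NavierStokesRegularity.NavierStokesRegularity.Theorems.PowerGaugeEulerLiouville.CasimirFloor (casimirFloor)

open scoped Real

/-- **The mirror-outgoing stratum is empty, GIVEN the lever M1** (`Sig.stub_momentMonotone → Sig.stub_mirrorOutgoing`-shape, all line
`def`s unfolded): M2 `blobsPersist_of_mirrorOutgoingWith` ∘ M3 `CasimirFloor.casimirFloor` ∘ M4 `mirrorEndgame` by name.
[cite: ChoiJeong2025, Lemma 3.3; CaffarelliKohnNirenberg1982, §2] -/
theorem mirrorOutgoing_ae_eq_zero_of_momentMonotone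
    (hM1 : ∀ (u : ℝ → EuclideanSpace ℝ (Fin 3) → EuclideanSpace ℝ (Fin 3)) (p : ℝ → EuclideanSpace ℝ (Fin 3) → ℝ) (R₀ β : ℝ),
      (IsClassicalEulerSolutionOn (Set.Iio 0) 0 u p ∧
        (∀ τ : ℝ, τ < 0 → IsAxisymmetric (u τ) ∧ HasNoSwirl (u τ)) ∧
        (∀ τ : ℝ, τ < 0 → ∀ x : EuclideanSpace ℝ (Fin 3),
          u τ (x - (2 * x 2) • (eZ : EuclideanSpace ℝ (Fin 3))) = u τ x - (2 * u τ x 2) • (eZ : EuclideanSpace ℝ (Fin 3))) ∧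
        (∀ τ : ℝ, τ < 0 → ∀ x : EuclideanSpace ℝ (Fin 3), 0 ≤ x 2 * swirl (curl (u τ)) x) ∧
        0 ≤ R₀ ∧ 0 ≤ β ∧
        (∀ τ : ℝ, τ < 0 → ∀ x : EuclideanSpace ℝ (Fin 3), R₀ * (1 + -τ) ^ β < cylRadius x → curl (u τ) x = 0) ∧
        (∀ τ : ℝ, τ < 0 →
          Integrable (fun x : EuclideanSpace ℝ (Fin 3) => (1 + ‖x‖) * ‖u τ x‖ ^ 2) ∧
            Integrable (fun x : EuclideanSpace ℝ (Fin 3) => (1 + ‖x‖) * (‖curl (u τ) x‖ / cylRadius x))) ∧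
        (∀ T T' : ℝ, T ≤ T' → T' < 0 → ∃ B : ℝ, ∀ τ ∈ Set.Icc T T', ∀ x : EuclideanSpace ℝ (Fin 3), ‖u τ x‖ ≤ B)) →
      ∀ τ₁ τ₂ : ℝ, τ₁ ≤ τ₂ → τ₂ < 0 →
        ∫ x, |x 2| * (‖curl (u τ₁) x‖ / cylRadius x) ≤ ∫ x, |x 2| * (‖curl (u τ₂) x‖ / cylRadius x)) :
    ∀ ρ : ℝ, 0 < ρ → ρ ≤ 1 / 2 →
      ∀ (u : ℝ → EuclideanSpace ℝ (Fin 3) → EuclideanSpace ℝ (Fin 3)) (p : ℝ → EuclideanSpace ℝ (Fin 3) → ℝ)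
        (H : ℝ → EuclideanSpace ℝ (Fin 3) → EuclideanSpace ℝ (Fin 3) →L[ℝ] EuclideanSpace ℝ (Fin 3)) (c : ℝ≥0),
        (IsSuitableWeakSolutionOn (slab (EuclideanSpace ℝ (Fin 3)) (Set.Iio 0) isOpen_Iio) 0 0 u p ∧
            HasWeakSpatialGradientOn (slab (EuclideanSpace ℝ (Fin 3)) (Set.Iio 0) isOpen_Iio) u H ∧
            (∀ a : ℝ, 0 < a →
              ENNReal.ofReal (a ^ (2 * ρ)) * cknA a (0 : ℝ × EuclideanSpace ℝ (Fin 3)) u +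
                    ENNReal.ofReal (a ^ ρ) * cknE a (0 : ℝ × EuclideanSpace ℝ (Fin 3)) H +
                  ENNReal.ofReal (a ^ (2 * ρ)) * cknD a (0 : ℝ × EuclideanSpace ℝ (Fin 3)) p ≤ (c : ℝ≥0∞))) →
          (∃ R₀ β : ℝ, β < 1 / (2 - ρ) ∧
              (IsClassicalEulerSolutionOn (Set.Iio 0) 0 u p ∧
                (∀ τ : ℝ, τ < 0 → IsAxisymmetric (u τ) ∧ HasNoSwirl (u τ)) ∧
                (∀ τ : ℝ, τ < 0 → ∀ x : EuclideanSpace ℝ (Fin 3),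
                  u τ (x - (2 * x 2) • (eZ : EuclideanSpace ℝ (Fin 3))) =
                    u τ x - (2 * u τ x 2) • (eZ : EuclideanSpace ℝ (Fin 3))) ∧
                (∀ τ : ℝ, τ < 0 → ∀ x : EuclideanSpace ℝ (Fin 3), 0 ≤ x 2 * swirl (curl (u τ)) x) ∧
                0 ≤ R₀ ∧ 0 ≤ β ∧
                (∀ τ : ℝ, τ < 0 → ∀ x : EuclideanSpace ℝ (Fin 3), R₀ * (1 + -τ) ^ β < cylRadius x → curl (u τ) x = 0) ∧
                (∀ τ : ℝ, τ < 0 →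
                  Integrable (fun x : EuclideanSpace ℝ (Fin 3) => (1 + ‖x‖) * ‖u τ x‖ ^ 2) ∧
                    Integrable (fun x : EuclideanSpace ℝ (Fin 3) => (1 + ‖x‖) * (‖curl (u τ) x‖ / cylRadius x))) ∧
                (∀ T T' : ℝ, T ≤ T' → T' < 0 →
                  ∃ B : ℝ, ∀ τ ∈ Set.Icc T T', ∀ x : EuclideanSpace ℝ (Fin 3), ‖u τ x‖ ≤ B))) →
            Function.uncurry u =ᵐ[volume.restrict (Set.Iio (0 : ℝ) ×ˢ (Set.univ : Set (EuclideanSpace ℝ (Fin 3))))] 0 := by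
  intro ρ hρ hρ2 u p H c hcls hS
  obtain ⟨R₀, β, hβ, hW⟩ := hS
  exact mirrorEndgame casimirFloor ρ hρ hρ2 u p H c hcls R₀ β hβ hW (hM1 u p R₀ β hW)
    (blobsPersist_of_mirrorOutgoingWith u p R₀ β hW)

/-! ### Appended 2026-08-28 ~11:10Z: M1 has landed (`…MirrorMomentLedgerBound`, ns-sfl-p1 g3), so the stratum is UNCONDITIONAL -/

/-- **THE MIRROR-OUTGOING STRATUM IS EMPTY** (unconditional; the skeleton's binder shape `InClass ρ u p H c → IsMirrorOutgoing ρ u p →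
VanishesAE u` for `0 < ρ ≤ 1/2`, every line `def` δ-unfolded): in the window, a member of Seregin's power-gauged ancient Euler class that is
classical, axisymmetric swirl-free, mirror-equivariant and outgoing, with vorticity inside the radially spreading cylinder
`r ≤ R₀(1+|τ|)^β`, `β < 1/(2−ρ)`, finite weighted energy / ledger moments per slice and slab-bounded velocity, vanishes a.e.  Assembly by
name: M1 `momentMonotone_of_mirrorOutgoingWith` (ns-sfl-p1) ∘ M2 `blobsPersist_of_mirrorOutgoingWith` (ns-ezl-w3) ∘ M3 `CasimirFloor.casimirFloor`
(ns-cas-k2) ∘ M4 `mirrorEndgame` (this seat).  One-name filler for the lead's `stub_mirrorOutgoing`.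
[cite: ChoiJeong2025, Lemma 3.3; CaffarelliKohnNirenberg1982, §2] -/
theorem mirrorOutgoing_ae_eq_zero :
    ∀ ρ : ℝ, 0 < ρ → ρ ≤ 1 / 2 →
      ∀ (u : ℝ → EuclideanSpace ℝ (Fin 3) → EuclideanSpace ℝ (Fin 3)) (p : ℝ → EuclideanSpace ℝ (Fin 3) → ℝ)
        (H : ℝ → EuclideanSpace ℝ (Fin 3) → EuclideanSpace ℝ (Fin 3) →L[ℝ] EuclideanSpace ℝ (Fin 3)) (c : ℝ≥0),
        (IsSuitableWeakSolutionOn (slab (EuclideanSpace ℝ (Fin 3)) (Set.Iio 0) isOpen_Iio) 0 0 u p ∧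
            HasWeakSpatialGradientOn (slab (EuclideanSpace ℝ (Fin 3)) (Set.Iio 0) isOpen_Iio) u H ∧
            (∀ a : ℝ, 0 < a →
              ENNReal.ofReal (a ^ (2 * ρ)) * cknA a (0 : ℝ × EuclideanSpace ℝ (Fin 3)) u +
                    ENNReal.ofReal (a ^ ρ) * cknE a (0 : ℝ × EuclideanSpace ℝ (Fin 3)) H +
                  ENNReal.ofReal (a ^ (2 * ρ)) * cknD a (0 : ℝ × EuclideanSpace ℝ (Fin 3)) p ≤ (c : ℝ≥0∞))) →
          (∃ R₀ β : ℝ, β < 1 / (2 - ρ) ∧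
              (IsClassicalEulerSolutionOn (Set.Iio 0) 0 u p ∧
                (∀ τ : ℝ, τ < 0 → IsAxisymmetric (u τ) ∧ HasNoSwirl (u τ)) ∧
                (∀ τ : ℝ, τ < 0 → ∀ x : EuclideanSpace ℝ (Fin 3),
                  u τ (x - (2 * x 2) • (eZ : EuclideanSpace ℝ (Fin 3))) =
                    u τ x - (2 * u τ x 2) • (eZ : EuclideanSpace ℝ (Fin 3))) ∧
                (∀ τ : ℝ, τ < 0 → ∀ x : EuclideanSpace ℝ (Fin 3), 0 ≤ x 2 * swirl (curl (u τ)) x) ∧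
                0 ≤ R₀ ∧ 0 ≤ β ∧
                (∀ τ : ℝ, τ < 0 → ∀ x : EuclideanSpace ℝ (Fin 3), R₀ * (1 + -τ) ^ β < cylRadius x → curl (u τ) x = 0) ∧
                (∀ τ : ℝ, τ < 0 →
                  Integrable (fun x : EuclideanSpace ℝ (Fin 3) => (1 + ‖x‖) * ‖u τ x‖ ^ 2) ∧
                    Integrable (fun x : EuclideanSpace ℝ (Fin 3) => (1 + ‖x‖) * (‖curl (u τ) x‖ / cylRadius x))) ∧
                (∀ T T' : ℝ, T ≤ T' → T' < 0 →
                  ∃ B : ℝ, ∀ τ ∈ Set.Icc T T', ∀ x : EuclideanSpace ℝ (Fin 3), ‖u τ x‖ ≤ B))) →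
            Function.uncurry u =ᵐ[volume.restrict (Set.Iio (0 : ℝ) ×ˢ (Set.univ : Set (EuclideanSpace ℝ (Fin 3))))] 0 :=
  mirrorOutgoing_ae_eq_zero_of_momentMonotone momentMonotone_of_mirrorOutgoingWith

end Summit.NavierStokesRegularity.NavierStokesRegularity.Theorems.PowerGaugeEulerLiouville.MirrorMoment

end
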